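import Literature.MathematicalPhysics.QuantumFieldTheory.SU2OneLinkIntegrals
import Literature.MathematicalPhysics.QuantumFieldTheory.OneLinkTraceShift
import HarnessLib

/-!
# Exact moment recurrence and sharp Laplace asymptotics of the SU(2) one-link weight `exp(B·Re tr W)`

Companion of `SU2OneLinkIntegrals.lean` (§3 there gives the ORDERS `E_B[(2 − Re tr W)^p] ≤ C_p/B^p`, `B ≥ 1`).  Here the
moments
`M_p(B) := ∫_{SU(2)} (2 − Re tr W)^p · e^{B·Re tr W} dW`            (`dW` = Haar probability, `M_0 = c(B)` the one-link
partition function) are controlled EXACTLY, for every real `B` and every `p : ℕ`, by integration by parts in the class-angle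
form (W) of Haar measure, `∫ g(Re tr W) dW = (2/π) ∫₀^π g(2cos θ) sin²θ dθ` [Montvay–Münster (3.96)–(3.97)]: the boundary-free
identity `∫₀^π d/dθ[sin θ · (2 − 2cos θ)^{p+1} · e^{2B cos θ}] dθ = 0` together with `sin²θ + cos²θ = 1` gives

* `2B · M_{p+1} = (2p+3) · M_p − ¼ · (2/π)∫₀^π (2 − 2cos θ)^{p+2} e^{2B cos θ} dθ`            (`angleMoment_succ_eq`, angle form),
* the THREE-TERM RECURRENCE `2B · M_{p+2} = (8B + 2p + 6) · M_{p+1} − 4(2p+3) · M_p`       (`integral_two_sub_re_trace_pow_mul_exp_recurrence`)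

— the latter is the recurrence `I_n − I_{n+2} = (2(n+1)/x) I_{n+1}` of the modified Bessel functions [DLMF 10.29.1] behind
`c(B) = I₁(2B)/B`, `∫ Re tr W e^{B Re tr W} dW = 2I₂(2B)/B` (tree: `SU2WilsonCharacterCoefficients`), written directly on the
moments.  Consequences (all `B > 0`, no largeness assumption):

* SHARP-CONSTANT UPPER BOUNDS `2B · M_{p+1} ≤ (2p+3) · M_p`, hence `E_B[(2 − Re tr W)^p] ≤ (2p+1)!! / (2B)^p`
  (`integral_two_sub_re_trace_pow_mul_exp_le_doubleFactorial`; `(2p+1)!!/(2B)^p` is the exact leading term: the law of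
  `2 − Re tr W ≈ θ²` is that of `|x|²`, `x` a centred Gaussian in `ℝ³` of covariance `(2B)⁻¹·1`);
* MATCHING LOWER BOUNDS `4(2p+3) · M_p ≤ (8B + 2p + 6) · M_{p+1}` (`B ≥ 0`);
* for the first moment: `6/(4B+3) ≤ E_B[2 − Re tr W] ≤ 3/(2B)`, so `|E_B[2 − Re tr W] − 3/(2B)| ≤ 9/(8B²)`;
  for the second: `E_B[(2 − Re tr W)²] ≤ 15/(4B²)` and exactly `B·M₂ = (4B+3)·M₁ − 6·M₀`;
* in Hilbert–Schmidt currency `‖W − 1‖_F² = 2(2 − Re tr W)` (Chatterjee's Lemma 7.2, tree `OneLinkTraceShift.card_sub_re_trace_eq`):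
  `12/(4B+3) ≤ E_B‖W − 1‖_F² ≤ 3/B`, **`|E_B‖W − 1‖_F² − 3/B| ≤ 9/(4B²)`**, `E_B‖W − 1‖_F⁴ ≤ 15/B²`, and exactly
  `B · E_B‖W − 1‖_F⁴ = 2(4B+3) · E_B‖W − 1‖_F² − 24`.

These are the «sharp one-link Laplace moments» asked for by the kinetic term of the AbsLower quasimode estimate of crux ONE of
`route-QuantumFields-LuscherReduction` (cell `ym-beyond`, card `Lines-energy-lower-abs-v2.md` §2; there `linkC B = M_0(B)`,
`linkM2 B = ∫ ‖W − 1‖_F² e^{B Re tr W} dW`).  Everything is PROVED; no definitions, no named facts.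

## References
* I. Montvay, G. Münster, *Quantum Fields on a Lattice*, CUP 1994, §3.2.3 (3.96)–(3.97) p. 121 (class-angle form of `SU(2)`
  Haar measure). [MontvayMunster1994]
* NIST DLMF §10.29, eq. 10.29.1 (recurrence of the modified Bessel functions). [DLMF]
* S. Chatterjee, arXiv:1602.01222, Lemma 7.2 (`N − Re tr U = ½‖1 − U‖²_F`). [arXiv160201222]
-/

noncomputable section

open MeasureTheory Real intervalIntegral

namespace Literature.MathematicalPhysics.QuantumFieldTheory.SU2OneLink

/-! ## §1  The class-angle side: integration by parts for `A_p(B) := ∫₀^π (2 − 2cos θ)^p e^{2B cos θ} sin²θ dθ` -/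

section Angle

/-- **Integration by parts for the class-angle moments**: for every `p : ℕ` and real `B`,
`2B ∫₀^π (2−2cos θ)^{p+1} e^{2Bcos θ} sin²θ dθ = ∫₀^π [cos θ (2−2cos θ)^{p+1} + 2(p+1)(2−2cos θ)^p sin²θ] e^{2Bcos θ} dθ`
(`∫₀^π (sin θ (2−2cos θ)^{p+1} e^{2Bcos θ})' dθ = 0`, the primitive vanishing at `0` and `π`).
[cite: MontvayMunster1994, §3.2.3 (3.97) p.121] -/
theorem angleMoment_ibp (p : ℕ) (B : ℝ) :
    2 * B * ∫ θ in (0:ℝ)..π, (2 - 2 * cos θ) ^ (p + 1) * exp (B * (2 * cos θ)) * sin θ ^ 2 =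
      ∫ θ in (0:ℝ)..π, (cos θ * (2 - 2 * cos θ) ^ (p + 1) + 2 * (p + 1) * ((2 - 2 * cos θ) ^ p * sin θ ^ 2)) *
        exp (B * (2 * cos θ)) := by
  have hderiv : ∀ θ : ℝ, HasDerivAt (fun x : ℝ => sin x * (2 - 2 * cos x) ^ (p + 1) * exp (B * (2 * cos x)))
      ((cos θ * (2 - 2 * cos θ) ^ (p + 1) + 2 * (p + 1) * ((2 - 2 * cos θ) ^ p * sin θ ^ 2)) * exp (B * (2 * cos θ))
        - 2 * B * ((2 - 2 * cos θ) ^ (p + 1) * exp (B * (2 * cos θ)) * sin θ ^ 2)) θ := by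
    intro θ
    have h1 : HasDerivAt (fun x : ℝ => 2 - 2 * cos x) (2 * sin θ) θ := by
      have h := ((hasDerivAt_cos θ).const_mul (2:ℝ)).const_sub (2:ℝ)
      exact h.congr_deriv (by ring)
    have h2 := h1.fun_pow (p + 1)
    have h3 : HasDerivAt (fun x : ℝ => exp (B * (2 * cos x))) (exp (B * (2 * cos θ)) * (B * (2 * -sin θ))) θ :=
      (((hasDerivAt_cos θ).const_mul 2).const_mul B).exp
    have h4 := ((hasDerivAt_sin θ).fun_mul h2).fun_mul h3
    refine h4.congr_deriv ?_
    simp only [Nat.add_sub_cancel, Nat.cast_add, Nat.cast_one]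
    ring
  have hint : IntervalIntegrable (fun θ : ℝ =>
      (cos θ * (2 - 2 * cos θ) ^ (p + 1) + 2 * (p + 1) * ((2 - 2 * cos θ) ^ p * sin θ ^ 2)) * exp (B * (2 * cos θ))
        - 2 * B * ((2 - 2 * cos θ) ^ (p + 1) * exp (B * (2 * cos θ)) * sin θ ^ 2)) volume 0 π :=
    (by fun_prop : Continuous fun θ : ℝ =>
      (cos θ * (2 - 2 * cos θ) ^ (p + 1) + 2 * (p + 1) * ((2 - 2 * cos θ) ^ p * sin θ ^ 2)) * exp (B * (2 * cos θ))
        - 2 * B * ((2 - 2 * cos θ) ^ (p + 1) * exp (B * (2 * cos θ)) * sin θ ^ 2)).intervalIntegrable _ _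
  have hftc := integral_eq_sub_of_hasDerivAt (fun θ _ => hderiv θ) hint
  simp only [sin_zero, sin_pi, zero_mul, sub_zero] at hftc
  have hX : IntervalIntegrable (fun θ : ℝ =>
      (cos θ * (2 - 2 * cos θ) ^ (p + 1) + 2 * (p + 1) * ((2 - 2 * cos θ) ^ p * sin θ ^ 2)) * exp (B * (2 * cos θ)))
      volume 0 π :=
    (by fun_prop : Continuous fun θ : ℝ =>
      (cos θ * (2 - 2 * cos θ) ^ (p + 1) + 2 * (p + 1) * ((2 - 2 * cos θ) ^ p * sin θ ^ 2)) *
        exp (B * (2 * cos θ))).intervalIntegrable _ _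
  have hY : IntervalIntegrable (fun θ : ℝ =>
      2 * B * ((2 - 2 * cos θ) ^ (p + 1) * exp (B * (2 * cos θ)) * sin θ ^ 2)) volume 0 π :=
    (by fun_prop : Continuous fun θ : ℝ =>
      2 * B * ((2 - 2 * cos θ) ^ (p + 1) * exp (B * (2 * cos θ)) * sin θ ^ 2)).intervalIntegrable _ _
  rw [integral_sub hX hY, intervalIntegral.integral_const_mul] at hftc
  linarith

/-- **First exact moment identity** (angle form): for every `p : ℕ` and real `B`,
`2B·A_{p+1} = (2p+3)·A_p − ¼ ∫₀^π (2−2cos θ)^{p+2} e^{2Bcos θ} dθ`, `A_p = ∫₀^π (2−2cos θ)^p e^{2Bcos θ} sin²θ dθ`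
(the IBP identity with `sin²θ = (2−2cos θ) − (2−2cos θ)²/4`). [cite: MontvayMunster1994, §3.2.3 (3.97) p.121] -/
theorem angleMoment_succ_eq (p : ℕ) (B : ℝ) :
    2 * B * ∫ θ in (0:ℝ)..π, (2 - 2 * cos θ) ^ (p + 1) * exp (B * (2 * cos θ)) * sin θ ^ 2 =
      (2 * p + 3) * (∫ θ in (0:ℝ)..π, (2 - 2 * cos θ) ^ p * exp (B * (2 * cos θ)) * sin θ ^ 2)
        - 1 / 4 * ∫ θ in (0:ℝ)..π, (2 - 2 * cos θ) ^ (p + 2) * exp (B * (2 * cos θ)) := by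
  have hX : IntervalIntegrable (fun θ : ℝ =>
      (2 * p + 3) * ((2 - 2 * cos θ) ^ p * exp (B * (2 * cos θ)) * sin θ ^ 2)) volume 0 π :=
    (by fun_prop : Continuous fun θ : ℝ =>
      (2 * p + 3) * ((2 - 2 * cos θ) ^ p * exp (B * (2 * cos θ)) * sin θ ^ 2)).intervalIntegrable _ _
  have hY : IntervalIntegrable (fun θ : ℝ =>
      1 / 4 * ((2 - 2 * cos θ) ^ (p + 2) * exp (B * (2 * cos θ)))) volume 0 π :=
    (by fun_prop : Continuous fun θ : ℝ =>
      1 / 4 * ((2 - 2 * cos θ) ^ (p + 2) * exp (B * (2 * cos θ)))).intervalIntegrable _ _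
  rw [angleMoment_ibp, ← intervalIntegral.integral_const_mul, ← intervalIntegral.integral_const_mul,
    ← integral_sub hX hY]
  refine integral_congr fun θ _ => ?_
  have h := sin_sq_add_cos_sq θ
  linear_combination (-(exp (B * (2 * cos θ)) * (2 - 2 * cos θ) ^ p)) * h

/-- **Second exact moment identity** (angle form): for every `p : ℕ` and real `B`,
`2B·A_{p+1} = (2p+4)·A_p − ∫₀^π (2−2cos θ)^{p+1} e^{2Bcos θ} dθ`. [cite: MontvayMunster1994, §3.2.3 (3.97) p.121] -/
theorem angleMoment_succ_eq' (p : ℕ) (B : ℝ) :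
    2 * B * ∫ θ in (0:ℝ)..π, (2 - 2 * cos θ) ^ (p + 1) * exp (B * (2 * cos θ)) * sin θ ^ 2 =
      (2 * p + 4) * (∫ θ in (0:ℝ)..π, (2 - 2 * cos θ) ^ p * exp (B * (2 * cos θ)) * sin θ ^ 2)
        - ∫ θ in (0:ℝ)..π, (2 - 2 * cos θ) ^ (p + 1) * exp (B * (2 * cos θ)) := by
  have hX : IntervalIntegrable (fun θ : ℝ =>
      (2 * p + 4) * ((2 - 2 * cos θ) ^ p * exp (B * (2 * cos θ)) * sin θ ^ 2)) volume 0 π :=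
    (by fun_prop : Continuous fun θ : ℝ =>
      (2 * p + 4) * ((2 - 2 * cos θ) ^ p * exp (B * (2 * cos θ)) * sin θ ^ 2)).intervalIntegrable _ _
  have hY : IntervalIntegrable (fun θ : ℝ =>
      (2 - 2 * cos θ) ^ (p + 1) * exp (B * (2 * cos θ))) volume 0 π :=
    (by fun_prop : Continuous fun θ : ℝ =>
      (2 - 2 * cos θ) ^ (p + 1) * exp (B * (2 * cos θ))).intervalIntegrable _ _
  rw [angleMoment_ibp, ← intervalIntegral.integral_const_mul, ← integral_sub hX hY]
  refine integral_congr fun θ _ => ?_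
  have h := sin_sq_add_cos_sq θ
  linear_combination (-(2 * exp (B * (2 * cos θ)) * (2 - 2 * cos θ) ^ p)) * h

/-- **Three-term recurrence of the class-angle moments**: for every `p : ℕ` and real `B`,
`2B·A_{p+2} = (8B + 2p + 6)·A_{p+1} − 4(2p+3)·A_p` (eliminate the `sin²`-free integral between the two exact identities;
this is DLMF 10.29.1 for the underlying `I_n(2B)`). [cite: DLMF, 10.29.1] -/
theorem angleMoment_recurrence (p : ℕ) (B : ℝ) :
    2 * B * ∫ θ in (0:ℝ)..π, (2 - 2 * cos θ) ^ (p + 2) * exp (B * (2 * cos θ)) * sin θ ^ 2 =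
      (8 * B + 2 * p + 6) * (∫ θ in (0:ℝ)..π, (2 - 2 * cos θ) ^ (p + 1) * exp (B * (2 * cos θ)) * sin θ ^ 2)
        - 4 * (2 * p + 3) * ∫ θ in (0:ℝ)..π, (2 - 2 * cos θ) ^ p * exp (B * (2 * cos θ)) * sin θ ^ 2 := by
  have h1 := angleMoment_succ_eq p B
  have h2 := angleMoment_succ_eq' (p + 1) B
  simp only [Nat.cast_add, Nat.cast_one, show p + 1 + 1 = p + 2 from rfl] at h2
  linear_combination h2 - 4 * h1

/-- `0 < A_p(B)` for every `p` and real `B` (the integrand is positive on `(0, π)`). [cite: MontvayMunster1994, §3.2.3 (3.97) p.121] -/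
theorem angleMoment_pos (p : ℕ) (B : ℝ) :
    0 < ∫ θ in (0:ℝ)..π, (2 - 2 * cos θ) ^ p * exp (B * (2 * cos θ)) * sin θ ^ 2 := by
  refine intervalIntegral_pos_of_pos_on
    ((by fun_prop : Continuous fun θ : ℝ => (2 - 2 * cos θ) ^ p * exp (B * (2 * cos θ)) * sin θ ^ 2).intervalIntegrable
      _ _) (fun θ hθ => ?_) pi_pos
  have hs : 0 < sin θ := sin_pos_of_pos_of_lt_pi hθ.1 hθ.2
  have hc : cos θ < cos 0 :=
    Real.strictAntiOn_cos (Set.left_mem_Icc.2 pi_pos.le) ⟨hθ.1.le, hθ.2.le⟩ hθ.1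
  rw [cos_zero] at hc
  have hv : 0 < 2 - 2 * cos θ := by linarith
  exact mul_pos (mul_pos (pow_pos hv p) (exp_pos _)) (pow_pos hs 2)

/-- **Sharp upper ratio bound** (angle form): `2B·A_{p+1} ≤ (2p+3)·A_p` for every `p : ℕ` and real `B`
(drop the nonnegative `sin²`-free integral in `angleMoment_succ_eq`). [cite: MontvayMunster1994, §3.2.3 (3.97) p.121] -/
theorem two_mul_mul_angleMoment_succ_le (p : ℕ) (B : ℝ) :
    2 * B * ∫ θ in (0:ℝ)..π, (2 - 2 * cos θ) ^ (p + 1) * exp (B * (2 * cos θ)) * sin θ ^ 2 ≤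
      (2 * p + 3) * ∫ θ in (0:ℝ)..π, (2 - 2 * cos θ) ^ p * exp (B * (2 * cos θ)) * sin θ ^ 2 := by
  rw [angleMoment_succ_eq]
  have hβ : 0 ≤ ∫ θ in (0:ℝ)..π, (2 - 2 * cos θ) ^ (p + 2) * exp (B * (2 * cos θ)) :=
    intervalIntegral.integral_nonneg pi_pos.le fun θ _ =>
      mul_nonneg (pow_nonneg (by linarith [cos_le_one θ]) _) (exp_pos _).le
  linarith

/-- **Lower ratio bound** (angle form): `4(2p+3)·A_p ≤ (8B + 2p + 6)·A_{p+1}` for `B ≥ 0`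
(drop `2B·A_{p+2} ≥ 0` in the recurrence). [cite: DLMF, 10.29.1] -/
theorem angleMoment_le_succ (p : ℕ) {B : ℝ} (hB : 0 ≤ B) :
    4 * (2 * p + 3) * ∫ θ in (0:ℝ)..π, (2 - 2 * cos θ) ^ p * exp (B * (2 * cos θ)) * sin θ ^ 2 ≤
      (8 * B + 2 * p + 6) * ∫ θ in (0:ℝ)..π, (2 - 2 * cos θ) ^ (p + 1) * exp (B * (2 * cos θ)) * sin θ ^ 2 := by
  have h := angleMoment_recurrence p B
  have hA := (angleMoment_pos (p + 2) B).le
  have h2 : 0 ≤ 2 * B * ∫ θ in (0:ℝ)..π, (2 - 2 * cos θ) ^ (p + 2) * exp (B * (2 * cos θ)) * sin θ ^ 2 :=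
    mul_nonneg (mul_nonneg two_pos.le hB) hA
  linarith

end Angle

/-! ## §2  The Haar side: moments `M_p(B) = ∫ (2 − Re tr W)^p e^{B Re tr W} dW` -/

section Haar

/-- **THREE-TERM RECURRENCE OF THE ONE-LINK MOMENTS**: for every `p : ℕ` and every real `B`,
`2B · ∫(2 − Re tr W)^{p+2} e^{B Re tr W} dW = (8B + 2p + 6) · ∫(2 − Re tr W)^{p+1} e^{B Re tr W} dW − 4(2p+3) · ∫(2 − Re tr W)^p e^{B Re tr W} dW`
(the class-angle recurrence transported by (W); equivalently DLMF 10.29.1 for `I_n(2B)`). [cite: DLMF, 10.29.1] -/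
theorem integral_two_sub_re_trace_pow_mul_exp_recurrence (p : ℕ) (B : ℝ) :
    2 * B * ∫ W, (2 - ((W : Matrix (Fin 2) (Fin 2) ℂ).trace).re) ^ (p + 2) *
        Real.exp (B * ((W : Matrix (Fin 2) (Fin 2) ℂ).trace).re) ∂(haarProbability (Matrix.specialUnitaryGroup (Fin 2) ℂ)) =
      (8 * B + 2 * p + 6) * (∫ W, (2 - ((W : Matrix (Fin 2) (Fin 2) ℂ).trace).re) ^ (p + 1) *
        Real.exp (B * ((W : Matrix (Fin 2) (Fin 2) ℂ).trace).re) ∂(haarProbability (Matrix.specialUnitaryGroup (Fin 2) ℂ)))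
      - 4 * (2 * p + 3) * ∫ W, (2 - ((W : Matrix (Fin 2) (Fin 2) ℂ).trace).re) ^ p *
        Real.exp (B * ((W : Matrix (Fin 2) (Fin 2) ℂ).trace).re) ∂(haarProbability (Matrix.specialUnitaryGroup (Fin 2) ℂ)) := by
  simp only [integral_two_sub_re_trace_pow_mul_exp_eq]
  have h := angleMoment_recurrence p B
  linear_combination (2 / π) * h

/-- **SHARP UPPER RATIO BOUND**: for every `p : ℕ` and every real `B`,
`2B · ∫(2 − Re tr W)^{p+1} e^{B Re tr W} dW ≤ (2p+3) · ∫(2 − Re tr W)^p e^{B Re tr W} dW`, i.e. `E_B[(2−Re tr)^{p+1}] ≤ (2p+3)/(2B) · E_B[(2−Re tr)^p]`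
for `B > 0` — the exact Gaussian ratio `(2p+3)·σ²`, `σ² = 1/(2B)`. [cite: MontvayMunster1994, §3.2.3 (3.96)-(3.97) p.121] -/
theorem two_mul_mul_integral_two_sub_re_trace_pow_succ_mul_exp_le (p : ℕ) (B : ℝ) :
    2 * B * ∫ W, (2 - ((W : Matrix (Fin 2) (Fin 2) ℂ).trace).re) ^ (p + 1) *
        Real.exp (B * ((W : Matrix (Fin 2) (Fin 2) ℂ).trace).re) ∂(haarProbability (Matrix.specialUnitaryGroup (Fin 2) ℂ)) ≤
      (2 * p + 3) * ∫ W, (2 - ((W : Matrix (Fin 2) (Fin 2) ℂ).trace).re) ^ p *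
        Real.exp (B * ((W : Matrix (Fin 2) (Fin 2) ℂ).trace).re) ∂(haarProbability (Matrix.specialUnitaryGroup (Fin 2) ℂ)) := by
  rw [integral_two_sub_re_trace_pow_mul_exp_eq, integral_two_sub_re_trace_pow_mul_exp_eq]
  have h := two_mul_mul_angleMoment_succ_le p B
  have hπ : (0:ℝ) ≤ 2 / π := by positivity
  calc 2 * B * (2 / π * ∫ θ in (0:ℝ)..π, (2 - 2 * cos θ) ^ (p + 1) * exp (B * (2 * cos θ)) * sin θ ^ 2)
      = 2 / π * (2 * B * ∫ θ in (0:ℝ)..π, (2 - 2 * cos θ) ^ (p + 1) * exp (B * (2 * cos θ)) * sin θ ^ 2) := by ring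
    _ ≤ 2 / π * ((2 * p + 3) * ∫ θ in (0:ℝ)..π, (2 - 2 * cos θ) ^ p * exp (B * (2 * cos θ)) * sin θ ^ 2) :=
      mul_le_mul_of_nonneg_left h hπ
    _ = _ := by ring

/-- **LOWER RATIO BOUND**: for every `p : ℕ` and `B ≥ 0`,
`4(2p+3) · ∫(2 − Re tr W)^p e^{B Re tr W} dW ≤ (8B + 2p + 6) · ∫(2 − Re tr W)^{p+1} e^{B Re tr W} dW`, i.e.
`E_B[(2−Re tr)^{p+1}] ≥ (2p+3)/(2B + (p+3)/2) · E_B[(2−Re tr)^p]`. [cite: DLMF, 10.29.1] -/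
theorem mul_integral_two_sub_re_trace_pow_mul_exp_le_succ (p : ℕ) {B : ℝ} (hB : 0 ≤ B) :
    4 * (2 * p + 3) * ∫ W, (2 - ((W : Matrix (Fin 2) (Fin 2) ℂ).trace).re) ^ p *
        Real.exp (B * ((W : Matrix (Fin 2) (Fin 2) ℂ).trace).re) ∂(haarProbability (Matrix.specialUnitaryGroup (Fin 2) ℂ)) ≤
      (8 * B + 2 * p + 6) * ∫ W, (2 - ((W : Matrix (Fin 2) (Fin 2) ℂ).trace).re) ^ (p + 1) *
        Real.exp (B * ((W : Matrix (Fin 2) (Fin 2) ℂ).trace).re) ∂(haarProbability (Matrix.specialUnitaryGroup (Fin 2) ℂ)) := by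
  rw [integral_two_sub_re_trace_pow_mul_exp_eq, integral_two_sub_re_trace_pow_mul_exp_eq]
  have h := angleMoment_le_succ p hB
  have hπ : (0:ℝ) ≤ 2 / π := by positivity
  calc 4 * (2 * p + 3) * (2 / π * ∫ θ in (0:ℝ)..π, (2 - 2 * cos θ) ^ p * exp (B * (2 * cos θ)) * sin θ ^ 2)
      = 2 / π * (4 * (2 * p + 3) * ∫ θ in (0:ℝ)..π, (2 - 2 * cos θ) ^ p * exp (B * (2 * cos θ)) * sin θ ^ 2) := by ring
    _ ≤ 2 / π * ((8 * B + 2 * p + 6) *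
          ∫ θ in (0:ℝ)..π, (2 - 2 * cos θ) ^ (p + 1) * exp (B * (2 * cos θ)) * sin θ ^ 2) :=
      mul_le_mul_of_nonneg_left h hπ
    _ = _ := by ring

/-- `0 < ∫ (2 − Re tr W)^p e^{B Re tr W} dW` for every `p : ℕ` and every real `B`. [cite: MontvayMunster1994, §3.2.3 (3.97) p.121] -/
theorem integral_two_sub_re_trace_pow_mul_exp_pos (p : ℕ) (B : ℝ) :
    0 < ∫ W, (2 - ((W : Matrix (Fin 2) (Fin 2) ℂ).trace).re) ^ p *
        Real.exp (B * ((W : Matrix (Fin 2) (Fin 2) ℂ).trace).re) ∂(haarProbability (Matrix.specialUnitaryGroup (Fin 2) ℂ)) := by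
  rw [integral_two_sub_re_trace_pow_mul_exp_eq]
  exact mul_pos (by positivity) (angleMoment_pos p B)

/-- `0 < c(B) = ∫ e^{B Re tr W} dW` for EVERY real `B` (the tree's `integral_exp_mul_re_trace_pos` assumes `B ≥ 1`).
[cite: MontvayMunster1994, §3.2.3 (3.97) p.121] -/
theorem integral_exp_mul_re_trace_pos' (B : ℝ) :
    0 < ∫ W, Real.exp (B * ((W : Matrix (Fin 2) (Fin 2) ℂ).trace).re) ∂(haarProbability (Matrix.specialUnitaryGroup (Fin 2) ℂ)) := by
  have h := integral_two_sub_re_trace_pow_mul_exp_pos 0 B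
  simpa only [pow_zero, one_mul] using h

/-- **THE ONE-LINK MOMENTS WITH THE SHARP GAUSSIAN CONSTANT**: for `B > 0` and every `p : ℕ`,
`∫ (2 − Re tr W)^p e^{B Re tr W} dW ≤ (2p+1)!!/(2B)^p · ∫ e^{B Re tr W} dW`, i.e. `E_B[(2 − Re tr W)^p] ≤ (2p+1)!!/(2B)^p`
(`= E|x|^{2p}` for `x ~ N(0, (2B)⁻¹·1_3)`; valid for ALL `B > 0`, sharpening `integral_two_sub_re_trace_pow_mul_exp_le`).
[cite: MontvayMunster1994, §3.2.3 (3.96)-(3.97) p.121] -/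
theorem integral_two_sub_re_trace_pow_mul_exp_le_doubleFactorial (p : ℕ) {B : ℝ} (hB : 0 < B) :
    ∫ W, (2 - ((W : Matrix (Fin 2) (Fin 2) ℂ).trace).re) ^ p *
        Real.exp (B * ((W : Matrix (Fin 2) (Fin 2) ℂ).trace).re) ∂(haarProbability (Matrix.specialUnitaryGroup (Fin 2) ℂ)) ≤
      ((2 * p + 1).doubleFactorial : ℝ) / (2 * B) ^ p *
        ∫ W, Real.exp (B * ((W : Matrix (Fin 2) (Fin 2) ℂ).trace).re) ∂(haarProbability (Matrix.specialUnitaryGroup (Fin 2) ℂ)) := by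
  induction p with
  | zero => simp
  | succ p ih =>
    have hstep := two_mul_mul_integral_two_sub_re_trace_pow_succ_mul_exp_le p B
    have hc := (integral_exp_mul_re_trace_pos' B).le
    have hdf : ((2 * (p + 1) + 1).doubleFactorial : ℝ) = (2 * p + 3) * ((2 * p + 1).doubleFactorial : ℝ) := by
      rw [show 2 * (p + 1) + 1 = 2 * p + 1 + 2 by ring, Nat.doubleFactorial_add_two]
      push_cast
      ring
    rw [hdf]
    -- `M_{p+1} ≤ (2p+3)/(2B) · M_p ≤ (2p+3)/(2B) · (2p+1)!!/(2B)^p · c`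
    have h1 : ∫ W, (2 - ((W : Matrix (Fin 2) (Fin 2) ℂ).trace).re) ^ (p + 1) *
        Real.exp (B * ((W : Matrix (Fin 2) (Fin 2) ℂ).trace).re) ∂(haarProbability (Matrix.specialUnitaryGroup (Fin 2) ℂ)) ≤
        (2 * p + 3) / (2 * B) * ∫ W, (2 - ((W : Matrix (Fin 2) (Fin 2) ℂ).trace).re) ^ p *
          Real.exp (B * ((W : Matrix (Fin 2) (Fin 2) ℂ).trace).re) ∂(haarProbability (Matrix.specialUnitaryGroup (Fin 2) ℂ)) := by
      rw [div_mul_eq_mul_div, le_div_iff₀ (by positivity)]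
      linarith
    refine h1.trans ?_
    have h2 := mul_le_mul_of_nonneg_left ih (show (0:ℝ) ≤ (2 * p + 3) / (2 * B) by positivity)
    refine h2.trans (le_of_eq ?_)
    rw [pow_succ]
    field_simp

/-- **FIRST MOMENT, upper**: `∫ (2 − Re tr W) e^{B Re tr W} dW ≤ 3/(2B) · ∫ e^{B Re tr W} dW` for `B > 0`.
[cite: MontvayMunster1994, §3.2.3 (3.96)-(3.97) p.121] -/
theorem integral_two_sub_re_trace_mul_exp_le {B : ℝ} (hB : 0 < B) :
    ∫ W, (2 - ((W : Matrix (Fin 2) (Fin 2) ℂ).trace).re) *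
        Real.exp (B * ((W : Matrix (Fin 2) (Fin 2) ℂ).trace).re) ∂(haarProbability (Matrix.specialUnitaryGroup (Fin 2) ℂ)) ≤
      3 / (2 * B) * ∫ W, Real.exp (B * ((W : Matrix (Fin 2) (Fin 2) ℂ).trace).re) ∂(haarProbability (Matrix.specialUnitaryGroup (Fin 2) ℂ)) := by
  have h := integral_two_sub_re_trace_pow_mul_exp_le_doubleFactorial 1 hB
  simp only [pow_one, mul_one] at h
  have hdf : ((2 * 1 + 1).doubleFactorial : ℝ) = 3 := by norm_num [Nat.doubleFactorial]
  rw [hdf] at h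
  exact h

/-- **FIRST MOMENT, lower**: `6 · ∫ e^{B Re tr W} dW ≤ (4B+3) · ∫ (2 − Re tr W) e^{B Re tr W} dW` for `B ≥ 0`
(`E_B[2 − Re tr W] ≥ 6/(4B+3) = 3/(2B) − 9/(2B(4B+3))`). [cite: DLMF, 10.29.1] -/
theorem mul_integral_exp_le_integral_two_sub_re_trace_mul_exp {B : ℝ} (hB : 0 ≤ B) :
    6 * ∫ W, Real.exp (B * ((W : Matrix (Fin 2) (Fin 2) ℂ).trace).re) ∂(haarProbability (Matrix.specialUnitaryGroup (Fin 2) ℂ)) ≤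
      (4 * B + 3) * ∫ W, (2 - ((W : Matrix (Fin 2) (Fin 2) ℂ).trace).re) *
        Real.exp (B * ((W : Matrix (Fin 2) (Fin 2) ℂ).trace).re) ∂(haarProbability (Matrix.specialUnitaryGroup (Fin 2) ℂ)) := by
  have h := mul_integral_two_sub_re_trace_pow_mul_exp_le_succ 0 hB
  simp only [pow_zero, one_mul, Nat.cast_zero, mul_zero, zero_add, pow_one] at h
  linarith

/-- **FIRST MOMENT, two-sided in expectation form**: for `B > 0`,
`6/(4B+3) ≤ E_B[2 − Re tr W] ≤ 3/(2B)`, `E_B[f] = ∫ f e^{B Re tr W} dW / ∫ e^{B Re tr W} dW`.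
[cite: MontvayMunster1994, §3.2.3 (3.96)-(3.97) p.121] -/
theorem integral_two_sub_re_trace_mul_exp_div_mem_Icc {B : ℝ} (hB : 0 < B) :
    (∫ W, (2 - ((W : Matrix (Fin 2) (Fin 2) ℂ).trace).re) *
        Real.exp (B * ((W : Matrix (Fin 2) (Fin 2) ℂ).trace).re) ∂(haarProbability (Matrix.specialUnitaryGroup (Fin 2) ℂ))) /
      (∫ W, Real.exp (B * ((W : Matrix (Fin 2) (Fin 2) ℂ).trace).re) ∂(haarProbability (Matrix.specialUnitaryGroup (Fin 2) ℂ))) ∈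
      Set.Icc (6 / (4 * B + 3)) (3 / (2 * B)) := by
  have hc := integral_exp_mul_re_trace_pos' B
  constructor
  · rw [div_le_div_iff₀ (by positivity) hc]
    have h := mul_integral_exp_le_integral_two_sub_re_trace_mul_exp hB.le
    linarith
  · rw [div_le_iff₀ hc]
    exact integral_two_sub_re_trace_mul_exp_le hB

/-- **SHARP FIRST MOMENT**: for `B > 0`, `|E_B[2 − Re tr W] − 3/(2B)| ≤ 9/(8B²)` (indeed `0 ≤ 3/(2B) − E_B[2 − Re tr W] ≤ 9/(2B(4B+3))`;
the true second-order term is `−3/(16B²)`). [cite: MontvayMunster1994, §3.2.3 (3.96)-(3.97) p.121] -/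
theorem abs_integral_two_sub_re_trace_mul_exp_div_sub_le {B : ℝ} (hB : 0 < B) :
    |(∫ W, (2 - ((W : Matrix (Fin 2) (Fin 2) ℂ).trace).re) *
        Real.exp (B * ((W : Matrix (Fin 2) (Fin 2) ℂ).trace).re) ∂(haarProbability (Matrix.specialUnitaryGroup (Fin 2) ℂ))) /
      (∫ W, Real.exp (B * ((W : Matrix (Fin 2) (Fin 2) ℂ).trace).re) ∂(haarProbability (Matrix.specialUnitaryGroup (Fin 2) ℂ)))
      - 3 / (2 * B)| ≤ 9 / (8 * B ^ 2) := by
  obtain ⟨hlo, hhi⟩ := integral_two_sub_re_trace_mul_exp_div_mem_Icc hB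
  rw [abs_sub_comm, abs_of_nonneg (by linarith)]
  have hgap : 3 / (2 * B) - 6 / (4 * B + 3) ≤ 9 / (8 * B ^ 2) := by
    rw [div_sub_div _ _ (by positivity) (by positivity), div_le_div_iff₀ (by positivity) (by positivity)]
    nlinarith [hB]
  linarith

/-- **SECOND MOMENT, exact**: `B · M₂ = (4B+3) · M₁ − 6 · M₀` for every real `B` (the recurrence at `p = 0`).
[cite: DLMF, 10.29.1] -/
theorem mul_integral_two_sub_re_trace_sq_mul_exp_eq (B : ℝ) :
    B * ∫ W, (2 - ((W : Matrix (Fin 2) (Fin 2) ℂ).trace).re) ^ 2 *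
        Real.exp (B * ((W : Matrix (Fin 2) (Fin 2) ℂ).trace).re) ∂(haarProbability (Matrix.specialUnitaryGroup (Fin 2) ℂ)) =
      (4 * B + 3) * (∫ W, (2 - ((W : Matrix (Fin 2) (Fin 2) ℂ).trace).re) *
        Real.exp (B * ((W : Matrix (Fin 2) (Fin 2) ℂ).trace).re) ∂(haarProbability (Matrix.specialUnitaryGroup (Fin 2) ℂ)))
      - 6 * ∫ W, Real.exp (B * ((W : Matrix (Fin 2) (Fin 2) ℂ).trace).re) ∂(haarProbability (Matrix.specialUnitaryGroup (Fin 2) ℂ)) := by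
  have h := integral_two_sub_re_trace_pow_mul_exp_recurrence 0 B
  simp only [pow_zero, one_mul, Nat.cast_zero, mul_zero, add_zero, zero_add, pow_one] at h
  linarith

/-- **SECOND MOMENT, sharp upper bound**: `∫ (2 − Re tr W)² e^{B Re tr W} dW ≤ 15/(4B²) · ∫ e^{B Re tr W} dW` for `B > 0`
(`E_B[(2 − Re tr W)²] ≤ 15/(4B²)`, the exact Gaussian fourth moment). [cite: MontvayMunster1994, §3.2.3 (3.96)-(3.97) p.121] -/
theorem integral_two_sub_re_trace_sq_mul_exp_le {B : ℝ} (hB : 0 < B) :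
    ∫ W, (2 - ((W : Matrix (Fin 2) (Fin 2) ℂ).trace).re) ^ 2 *
        Real.exp (B * ((W : Matrix (Fin 2) (Fin 2) ℂ).trace).re) ∂(haarProbability (Matrix.specialUnitaryGroup (Fin 2) ℂ)) ≤
      15 / (4 * B ^ 2) * ∫ W, Real.exp (B * ((W : Matrix (Fin 2) (Fin 2) ℂ).trace).re) ∂(haarProbability (Matrix.specialUnitaryGroup (Fin 2) ℂ)) := by
  have h := integral_two_sub_re_trace_pow_mul_exp_le_doubleFactorial 2 hB
  have hdf : ((2 * 2 + 1).doubleFactorial : ℝ) = 15 := by norm_num [Nat.doubleFactorial]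
  rw [hdf] at h
  refine h.trans (le_of_eq ?_)
  congr 1
  rw [mul_pow]; norm_num

end Haar

/-! ## §3  Hilbert–Schmidt currency `‖W − 1‖_F² = 2(2 − Re tr W)` -/

section Frobenius

open Literature.MathematicalPhysics.QuantumFieldTheory (frobNorm)
open Literature.MathematicalPhysics.QuantumFieldTheory.OneLinkTraceShift (card_sub_re_trace_eq)

/-- `‖W − 1‖_F² = 2(2 − Re tr W)` on `SU(2)`. [cite: arXiv160201222, Lemma 7.2] -/
theorem frobNorm_sub_one_sq_eq (W : Matrix.specialUnitaryGroup (Fin 2) ℂ) :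
    frobNorm ((W : Matrix (Fin 2) (Fin 2) ℂ) - 1) ^ 2 = 2 * (2 - ((W : Matrix (Fin 2) (Fin 2) ℂ).trace).re) := by
  have h := card_sub_re_trace_eq (Matrix.mem_specialUnitaryGroup_iff.mp W.2).1
  simp only [Nat.cast_ofNat] at h
  linarith

/-- `∫ ‖W − 1‖_F² e^{B Re tr W} dW = 2 · ∫ (2 − Re tr W) e^{B Re tr W} dW`. [cite: arXiv160201222, Lemma 7.2] -/
theorem integral_frobNorm_sub_one_sq_mul_exp_eq (B : ℝ) :
    ∫ W, frobNorm ((W : Matrix (Fin 2) (Fin 2) ℂ) - 1) ^ 2 *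
        Real.exp (B * ((W : Matrix (Fin 2) (Fin 2) ℂ).trace).re) ∂(haarProbability (Matrix.specialUnitaryGroup (Fin 2) ℂ)) =
      2 * ∫ W, (2 - ((W : Matrix (Fin 2) (Fin 2) ℂ).trace).re) *
        Real.exp (B * ((W : Matrix (Fin 2) (Fin 2) ℂ).trace).re) ∂(haarProbability (Matrix.specialUnitaryGroup (Fin 2) ℂ)) := by
  rw [← MeasureTheory.integral_const_mul]
  refine integral_congr_ae (ae_of_all _ fun W => ?_)
  simp only [frobNorm_sub_one_sq_eq]
  ring

/-- `∫ ‖W − 1‖_F⁴ e^{B Re tr W} dW = 4 · ∫ (2 − Re tr W)² e^{B Re tr W} dW`. [cite: arXiv160201222, Lemma 7.2] -/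
theorem integral_frobNorm_sub_one_pow_four_mul_exp_eq (B : ℝ) :
    ∫ W, frobNorm ((W : Matrix (Fin 2) (Fin 2) ℂ) - 1) ^ 4 *
        Real.exp (B * ((W : Matrix (Fin 2) (Fin 2) ℂ).trace).re) ∂(haarProbability (Matrix.specialUnitaryGroup (Fin 2) ℂ)) =
      4 * ∫ W, (2 - ((W : Matrix (Fin 2) (Fin 2) ℂ).trace).re) ^ 2 *
        Real.exp (B * ((W : Matrix (Fin 2) (Fin 2) ℂ).trace).re) ∂(haarProbability (Matrix.specialUnitaryGroup (Fin 2) ℂ)) := by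
  rw [← MeasureTheory.integral_const_mul]
  refine integral_congr_ae (ae_of_all _ fun W => ?_)
  simp only
  rw [show (4 : ℕ) = 2 * 2 from rfl, pow_mul, frobNorm_sub_one_sq_eq]
  ring

/-- **`E_B‖W − 1‖_F² ≤ 3/B`**: `∫ ‖W − 1‖_F² e^{B Re tr W} dW ≤ (3/B) · ∫ e^{B Re tr W} dW` for `B > 0`.
[cite: MontvayMunster1994, §3.2.3 (3.96)-(3.97) p.121] -/
theorem integral_frobNorm_sub_one_sq_mul_exp_le {B : ℝ} (hB : 0 < B) :
    ∫ W, frobNorm ((W : Matrix (Fin 2) (Fin 2) ℂ) - 1) ^ 2 *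
        Real.exp (B * ((W : Matrix (Fin 2) (Fin 2) ℂ).trace).re) ∂(haarProbability (Matrix.specialUnitaryGroup (Fin 2) ℂ)) ≤
      3 / B * ∫ W, Real.exp (B * ((W : Matrix (Fin 2) (Fin 2) ℂ).trace).re) ∂(haarProbability (Matrix.specialUnitaryGroup (Fin 2) ℂ)) := by
  rw [integral_frobNorm_sub_one_sq_mul_exp_eq]
  have h := integral_two_sub_re_trace_mul_exp_le hB
  calc 2 * ∫ W, (2 - ((W : Matrix (Fin 2) (Fin 2) ℂ).trace).re) *
          Real.exp (B * ((W : Matrix (Fin 2) (Fin 2) ℂ).trace).re) ∂(haarProbability (Matrix.specialUnitaryGroup (Fin 2) ℂ))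
      ≤ 2 * (3 / (2 * B) * ∫ W, Real.exp (B * ((W : Matrix (Fin 2) (Fin 2) ℂ).trace).re)
          ∂(haarProbability (Matrix.specialUnitaryGroup (Fin 2) ℂ))) := by linarith
    _ = _ := by field_simp

/-- **`E_B‖W − 1‖_F² ≥ 12/(4B+3)`**: `12 · ∫ e^{B Re tr W} dW ≤ (4B+3) · ∫ ‖W − 1‖_F² e^{B Re tr W} dW` for `B ≥ 0`.
[cite: DLMF, 10.29.1] -/
theorem mul_integral_exp_le_integral_frobNorm_sub_one_sq_mul_exp {B : ℝ} (hB : 0 ≤ B) :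
    12 * ∫ W, Real.exp (B * ((W : Matrix (Fin 2) (Fin 2) ℂ).trace).re) ∂(haarProbability (Matrix.specialUnitaryGroup (Fin 2) ℂ)) ≤
      (4 * B + 3) * ∫ W, frobNorm ((W : Matrix (Fin 2) (Fin 2) ℂ) - 1) ^ 2 *
        Real.exp (B * ((W : Matrix (Fin 2) (Fin 2) ℂ).trace).re) ∂(haarProbability (Matrix.specialUnitaryGroup (Fin 2) ℂ)) := by
  rw [integral_frobNorm_sub_one_sq_mul_exp_eq]
  have h := mul_integral_exp_le_integral_two_sub_re_trace_mul_exp hB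
  linarith

/-- **THE SHARP HILBERT–SCHMIDT SECOND MOMENT OF THE ONE-LINK WEIGHT**: for `B > 0`,
`12/(4B+3) ≤ E_B‖W − 1‖_F² ≤ 3/B`, where `E_B‖W − 1‖_F² = ∫ ‖W − 1‖_F² e^{B Re tr W} dW / ∫ e^{B Re tr W} dW`
(in the notation of the cell's W1-up chain: `linkM2 B / linkC B`). [cite: MontvayMunster1994, §3.2.3 (3.96)-(3.97) p.121] -/
theorem integral_frobNorm_sub_one_sq_mul_exp_div_mem_Icc {B : ℝ} (hB : 0 < B) :
    (∫ W, frobNorm ((W : Matrix (Fin 2) (Fin 2) ℂ) - 1) ^ 2 *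
        Real.exp (B * ((W : Matrix (Fin 2) (Fin 2) ℂ).trace).re) ∂(haarProbability (Matrix.specialUnitaryGroup (Fin 2) ℂ))) /
      (∫ W, Real.exp (B * ((W : Matrix (Fin 2) (Fin 2) ℂ).trace).re) ∂(haarProbability (Matrix.specialUnitaryGroup (Fin 2) ℂ))) ∈
      Set.Icc (12 / (4 * B + 3)) (3 / B) := by
  have hc := integral_exp_mul_re_trace_pos' B
  constructor
  · rw [div_le_div_iff₀ (by positivity) hc]
    have h := mul_integral_exp_le_integral_frobNorm_sub_one_sq_mul_exp hB.le
    linarith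
  · rw [div_le_iff₀ hc]
    exact integral_frobNorm_sub_one_sq_mul_exp_le hB

/-- **`|E_B‖W − 1‖_F² − 3/B| ≤ 9/(4B²)`** for `B > 0` (indeed `0 ≤ 3/B − E_B‖W − 1‖_F² ≤ 9/(B(4B+3))`; the true second-order
term is `−3/(8B²)`) — the «sharp one-link Laplace moment» of the AbsLower kinetic estimate.
[cite: MontvayMunster1994, §3.2.3 (3.96)-(3.97) p.121] -/
theorem abs_integral_frobNorm_sub_one_sq_mul_exp_div_sub_le {B : ℝ} (hB : 0 < B) :
    |(∫ W, frobNorm ((W : Matrix (Fin 2) (Fin 2) ℂ) - 1) ^ 2 *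
        Real.exp (B * ((W : Matrix (Fin 2) (Fin 2) ℂ).trace).re) ∂(haarProbability (Matrix.specialUnitaryGroup (Fin 2) ℂ))) /
      (∫ W, Real.exp (B * ((W : Matrix (Fin 2) (Fin 2) ℂ).trace).re) ∂(haarProbability (Matrix.specialUnitaryGroup (Fin 2) ℂ)))
      - 3 / B| ≤ 9 / (4 * B ^ 2) := by
  obtain ⟨hlo, hhi⟩ := integral_frobNorm_sub_one_sq_mul_exp_div_mem_Icc hB
  rw [abs_sub_comm, abs_of_nonneg (by linarith)]
  have hgap : 3 / B - 12 / (4 * B + 3) ≤ 9 / (4 * B ^ 2) := by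
    rw [div_sub_div _ _ hB.ne' (by positivity), div_le_div_iff₀ (by positivity) (by positivity)]
    nlinarith [hB]
  linarith

/-- **FOURTH HILBERT–SCHMIDT MOMENT, exact**: `B · ∫ ‖W − 1‖_F⁴ e^{B Re tr W} = 2(4B+3) · ∫ ‖W − 1‖_F² e^{B Re tr W} − 24 · ∫ e^{B Re tr W}`
for every real `B`. [cite: DLMF, 10.29.1] -/
theorem mul_integral_frobNorm_sub_one_pow_four_mul_exp_eq (B : ℝ) :
    B * ∫ W, frobNorm ((W : Matrix (Fin 2) (Fin 2) ℂ) - 1) ^ 4 *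
        Real.exp (B * ((W : Matrix (Fin 2) (Fin 2) ℂ).trace).re) ∂(haarProbability (Matrix.specialUnitaryGroup (Fin 2) ℂ)) =
      2 * (4 * B + 3) * (∫ W, frobNorm ((W : Matrix (Fin 2) (Fin 2) ℂ) - 1) ^ 2 *
        Real.exp (B * ((W : Matrix (Fin 2) (Fin 2) ℂ).trace).re) ∂(haarProbability (Matrix.specialUnitaryGroup (Fin 2) ℂ)))
      - 24 * ∫ W, Real.exp (B * ((W : Matrix (Fin 2) (Fin 2) ℂ).trace).re) ∂(haarProbability (Matrix.specialUnitaryGroup (Fin 2) ℂ)) := by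
  rw [integral_frobNorm_sub_one_pow_four_mul_exp_eq, integral_frobNorm_sub_one_sq_mul_exp_eq]
  have h := mul_integral_two_sub_re_trace_sq_mul_exp_eq B
  linear_combination 4 * h

/-- **FOURTH HILBERT–SCHMIDT MOMENT, sharp upper bound**: `∫ ‖W − 1‖_F⁴ e^{B Re tr W} dW ≤ (15/B²) · ∫ e^{B Re tr W} dW` for `B > 0`
(`E_B‖W − 1‖_F⁴ ≤ 15/B²`). [cite: MontvayMunster1994, §3.2.3 (3.96)-(3.97) p.121] -/
theorem integral_frobNorm_sub_one_pow_four_mul_exp_le {B : ℝ} (hB : 0 < B) :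
    ∫ W, frobNorm ((W : Matrix (Fin 2) (Fin 2) ℂ) - 1) ^ 4 *
        Real.exp (B * ((W : Matrix (Fin 2) (Fin 2) ℂ).trace).re) ∂(haarProbability (Matrix.specialUnitaryGroup (Fin 2) ℂ)) ≤
      15 / B ^ 2 * ∫ W, Real.exp (B * ((W : Matrix (Fin 2) (Fin 2) ℂ).trace).re) ∂(haarProbability (Matrix.specialUnitaryGroup (Fin 2) ℂ)) := by
  rw [integral_frobNorm_sub_one_pow_four_mul_exp_eq]
  have h := integral_two_sub_re_trace_sq_mul_exp_le hB
  calc 4 * ∫ W, (2 - ((W : Matrix (Fin 2) (Fin 2) ℂ).trace).re) ^ 2 *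
          Real.exp (B * ((W : Matrix (Fin 2) (Fin 2) ℂ).trace).re) ∂(haarProbability (Matrix.specialUnitaryGroup (Fin 2) ℂ))
      ≤ 4 * (15 / (4 * B ^ 2) * ∫ W, Real.exp (B * ((W : Matrix (Fin 2) (Fin 2) ℂ).trace).re)
          ∂(haarProbability (Matrix.specialUnitaryGroup (Fin 2) ℂ))) := by linarith
    _ = _ := by field_simp

/-- The fourth moment in expectation form: `E_B‖W − 1‖_F⁴ ≤ 15/B²` for `B > 0`. [cite: MontvayMunster1994, §3.2.3 (3.96)-(3.97) p.121] -/
theorem integral_frobNorm_sub_one_pow_four_mul_exp_div_le {B : ℝ} (hB : 0 < B) :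
    (∫ W, frobNorm ((W : Matrix (Fin 2) (Fin 2) ℂ) - 1) ^ 4 *
        Real.exp (B * ((W : Matrix (Fin 2) (Fin 2) ℂ).trace).re) ∂(haarProbability (Matrix.specialUnitaryGroup (Fin 2) ℂ))) /
      (∫ W, Real.exp (B * ((W : Matrix (Fin 2) (Fin 2) ℂ).trace).re) ∂(haarProbability (Matrix.specialUnitaryGroup (Fin 2) ℂ))) ≤
      15 / B ^ 2 :=
  (div_le_iff₀ (integral_exp_mul_re_trace_pos' B)).mpr (integral_frobNorm_sub_one_pow_four_mul_exp_le hB)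

end Frobenius

end Literature.MathematicalPhysics.QuantumFieldTheory.SU2OneLink
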